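import Literature.Topology.FourManifolds.TrisectionsMidSectorFlowRule
import Literature.Topology.FourManifolds.TrisectionsMidSectorColumn
import Literature.Topology.FourManifolds.TrisectionsH23Lid
import Literature.Topology.FourManifolds.TrisectionsSectorMorse
import Literature.Topology.FourManifolds.TrisectionsHandleCounts
import Literature.Topology.FourManifolds.MorseExtrema
import Literature.Topology.FourManifolds.MorseTurnAbout
import Literature.Topology.FourManifolds.TrisectionsZetaFrame
import HarnessLib

/-!
# A boundary-adapted function on the middle sector `X₂` (Gay–Kirby 2016, Lemma 14), V:
# the fibres — one critical point of `ψ₂` over each critical point of `g` in `H₁₂` off the tubes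

Topic `Literature/Topology/FourManifolds`; infrastructure for the fact seat
`provefact-Literature.Topology.FourManifolds.exists_isBalancedGKTrisection` (Gay–Kirby 2016,
Thm. 4 via §4, Lemma 14).  Everything in this file is **proved**; no named facts are introduced.

In the flow-rule region `FR` of `TrisectionsMidSectorFlowRule.lean` the critical points of `ψ₂`
are the points where `∂₂Γ₂(φ̄, f) = 0` over the critical points of the Heegaard function `g`.
Along the fibre over a level point `y` with `g y < b`, `∂₂Γ₂(g y, q) = w(g y) · fib_y(q)` with the
explicit **fibre function** `fib_y(q) = m(g y, q) - (q - a) σ_ε'(q - c - (g y - b))`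
(`TriData.fib`), a function of the height `q` alone.  It is positive on the band
(`q ≤ a + δ_U`, by `4δ_U + 2ε ≤ c - a`), negative at the lid `q = c`, non-increasing on
`[a, ∞)` and strictly decreasing at its zeros; hence it has **exactly one zero** on `(a, ∞)`,
which lies in `(a + δ_U, c)` (`exists_fib_eq_zero`, `fib_eq_zero_unique`).  Consequently
(`MidParams.ncard_frCrit_eq`): the landing map `λ` is a bijection from the critical points of
`ψ₂` of index `i` in the flow-rule region onto `critY_i`, the critical points of `g` of index
`i` below `b` off the thin tubes (`TrisectionsH23Lid.lean`) — a landing point in a thin tube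
would be an axis point of the attaching circle, the critical point would lie on the core disc at
mid-height, at distance² `A_j = (η₂ - ν²)/2 < a_R` from the co-core, outside the flow-rule
region.

## References

* D. Gay, R. Kirby, *Trisecting 4-manifolds*, Geom. Topol. 20 (2016), §4, Lemma 14. [GayKirby2016]
* J. Milnor, *Morse theory* (1963), §3. [Milnor1963]
* J. Milnor, *Lectures on the h-cobordism theorem* (1965), Thm. 3.4, Thm. 3.13, Thm. 4.1. [MilnorHCobordism1965]
-/

open scoped Manifold ContDiff Topology
open Set Function Filter

noncomputable section

universe u

namespace Literature.Topology.FourManifolds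

open Flow

variable {X : Type u} [TopologicalSpace X] [T2Space X] [CompactSpace X]
  [ChartedSpace (EuclideanSpace ℝ (Fin 4)) X] [IsManifold (𝓡 4) ∞ X]

namespace BiCollar

/-! ### Level points, landing, and the flow -/

variable (B : BiCollar X) in
/-- The stable set of a point is invariant under the flow. [cite: MilnorHCobordism1965, Def. 3.9] -/
theorem flow_mem_stableSet {q y : X} (hy : y ∈ stableSet (𝓡 4) B.U.ξ q) (t : ℝ) :
    flow B.U.contMDiff y t ∈ stableSet (𝓡 4) B.U.ξ q := by
  rw [stableSet_eq_setOf_tendsto B.U.contMDiff] at hy ⊢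
  have h : Tendsto (flow B.U.contMDiff y) atTop (𝓝 q) := hy
  show Tendsto (flow B.U.contMDiff (flow B.U.contMDiff y t)) atTop (𝓝 q)
  have hfun : flow B.U.contMDiff (flow B.U.contMDiff y t) = fun s => flow B.U.contMDiff y (t + s) :=
    funext fun s => (flow_add B.U.contMDiff y t s).symm
  rw [hfun]
  exact h.comp (tendsto_atTop_add_const_left atTop t tendsto_id)

namespace TriData

variable {B : BiCollar X} (T : B.TriData)

include T in
/-- The landing point of a flowed level point is the level point. [folklore] -/
theorem lamLift_fl_level (y : B.Y) (t : ℝ) : B.lamLift (B.U.fl y.1 t) = y := by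
  have hy0 : B.Hit y.1 := B.hit_of_apply_eq y.2
  apply Subtype.ext
  show RegularLevel.incl B.hf (B.lamLift (B.U.fl y.1 t)) = y.1
  rw [B.incl_lamLift (B.hit_fl hy0 t), T.Fr.lam_fl hy0 t, T.Fr.lam_of_apply_eq y.2]

/-- Off the bevel support, `F₁ = s`. [folklore] -/
theorem F₁_eq_sFun_of_lt {p : X} (hs : T.D.χ₁.rOut < B.sFun p) : T.D.F₁ p = B.sFun p := by
  have hθ : T.D.θ p = 0 := T.D.θ_eq_zero_of_le (by rw [abs_of_pos (T.D.χ₁.rOut_pos.trans hs)]; exact hs.le)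
  show B.sFun p + T.D.κ * T.D.θ p = B.sFun p
  rw [hθ, mul_zero, add_zero]

/-- At an interior point of `X₂` which hits, the landing point lies in `{g < b}` (`G ≤ M < 0`). [folklore] -/
theorem g_lamLift_lt_b {p : X} (hx2 : p ∈ T.X₂) (hh : B.Hit p) (hM : T.Mt p ≠ 0) : B.g (B.lamLift p) < B.b := by
  have h1 := T.gFun_le_M p
  have h2 := T.neg_Mt_pos_of_mem_X₂ hx2 hM
  rw [T.Mt_of_hit hh] at h2
  have : B.gFun p = B.g (B.lamLift p) - B.b := rfl
  linarith

/-! ### The fibre function -/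

/-- **The fibre function** over a level point `y`: `fib_y(q) = m(g y, q) - (q - a) σ'(g y, q)`, so
that `∂₂Γ₂(g y, q) = w(g y) fib_y(q)`. [cite: GayKirby2016, §4, Lemma 14] -/
def fib (y : B.Y) (q : ℝ) : ℝ := T.mcr (B.g y, q) - (q - B.a) * T.σcr (B.g y, q)

omit [T2Space X] [CompactSpace X] in
/-- Unfolding of the fibre function. [folklore] -/
theorem fib_apply (y : B.Y) (q : ℝ) : T.fib y q =
    -(B.g y - B.b) - creaseσ T.ε (q - T.c - (B.g y - B.b)) - (q - B.a) * creaseStep ((q - T.c - (B.g y - B.b)) / T.ε) := rfl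

omit [T2Space X] [CompactSpace X] in
/-- The fibre function is continuous. [folklore] -/
theorem continuous_fib (y : B.Y) : Continuous (T.fib y) := by
  show Continuous fun q => -(B.g y - B.b) - creaseσ T.ε (q - T.c - (B.g y - B.b)) -
    (q - B.a) * creaseStep ((q - T.c - (B.g y - B.b)) / T.ε)
  have h1 : Continuous fun q : ℝ => q - T.c - (B.g y - B.b) := (continuous_id.sub continuous_const).sub continuous_const
  exact (continuous_const.sub ((continuous_creaseσ T.ε).comp h1)).sub
    ((continuous_id.sub continuous_const).mul (continuous_creaseStep.comp (h1.div_const _)))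

omit [T2Space X] [CompactSpace X] in
/-- **The derivative of the fibre function**: `fib' = -(2σ' + (q - a) σ_ε''(w_c))`. [folklore] -/
theorem hasDerivAt_fib (y : B.Y) (q : ℝ) :
    HasDerivAt (T.fib y) (-(2 * T.σcr (B.g y, q) +
      (q - B.a) * (deriv creaseStep ((q - T.c - (B.g y - B.b)) / T.ε) / T.ε))) q := by
  have hε := T.ε_pos
  set K := T.c + (B.g y - B.b) with hK
  have hσ : HasDerivAt (fun q' : ℝ => creaseσ T.ε (q' - K)) (creaseStep ((q - K) / T.ε)) q :=
    (hasDerivAt_creaseσ hε (q - K)).comp_sub_const q K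
  have hlin : HasDerivAt (fun q' : ℝ => (q' - K) / T.ε) (1 / T.ε) q := by
    have := ((hasDerivAt_id q).sub_const K).div_const T.ε
    simpa using this
  have hstep : HasDerivAt (fun q' : ℝ => creaseStep ((q' - K) / T.ε)) (deriv creaseStep ((q - K) / T.ε) * (1 / T.ε)) q :=
    ((contDiff_creaseStep.differentiable (by simp)) _).hasDerivAt.comp q hlin
  have hqa : HasDerivAt (fun q' : ℝ => q' - B.a) 1 q := (hasDerivAt_id q).sub_const B.a
  have h : HasDerivAt (fun q' : ℝ => -(B.g y - B.b) - creaseσ T.ε (q' - K) - (q' - B.a) * creaseStep ((q' - K) / T.ε))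
      (0 - creaseStep ((q - K) / T.ε) - (1 * creaseStep ((q - K) / T.ε) + (q - B.a) * (deriv creaseStep ((q - K) / T.ε) * (1 / T.ε)))) q :=
    ((hasDerivAt_const q _).sub hσ).sub (hqa.mul hstep)
  have hfun : T.fib y = fun q' : ℝ => -(B.g y - B.b) - creaseσ T.ε (q' - K) - (q' - B.a) * creaseStep ((q' - K) / T.ε) := by
    funext q'; rw [fib_apply]; simp only [hK]; ring_nf
  rw [hfun]
  refine h.congr_deriv ?_
  have hwc : q - K = q - T.c - (B.g y - B.b) := by rw [hK]; ring
  simp only [TriData.σcr, TriData.wcr, hwc]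
  field_simp
  ring

omit [T2Space X] [CompactSpace X] in
/-- The derivative of the fibre function is `≤ 0` on `[a, ∞)`. [folklore] -/
theorem deriv_fib_nonpos (y : B.Y) {q : ℝ} (hq : B.a ≤ q) : deriv (T.fib y) q ≤ 0 := by
  rw [(T.hasDerivAt_fib y q).deriv]
  have h1 : 0 ≤ T.σcr (B.g y, q) := creaseStep_nonneg _
  have h2 : 0 ≤ (q - B.a) * (deriv creaseStep ((q - T.c - (B.g y - B.b)) / T.ε) / T.ε) :=
    mul_nonneg (by linarith) (div_nonneg (deriv_creaseStep_nonneg _) T.ε_pos.le)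
  linarith

omit [T2Space X] [CompactSpace X] in
/-- **The fibre function is non-increasing on `[a, ∞)`.** [folklore] -/
theorem fib_antitoneOn (y : B.Y) : AntitoneOn (T.fib y) (Ici B.a) :=
  antitoneOn_of_deriv_nonpos (convex_Ici B.a) (T.continuous_fib y).continuousOn
    (fun q _ => (T.hasDerivAt_fib y q).differentiableAt.differentiableWithinAt)
    (fun q hq => T.deriv_fib_nonpos y (by rw [interior_Ici] at hq; exact le_of_lt hq))

omit [T2Space X] [CompactSpace X] in
/-- `σ' = 0` forces `σ_ε(w_c) = 0`. [folklore] -/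
theorem creaseσ_eq_zero_of_σcr_eq_zero {p : ℝ × ℝ} (h : T.σcr p = 0) : creaseσ T.ε (T.wcr p) = 0 := by
  apply creaseσ_of_le_neg T.ε_pos
  by_contra hlt
  push Not at hlt
  have : -1 < T.wcr p / T.ε := by rw [lt_div_iff₀ T.ε_pos]; linarith
  exact absurd h (creaseStep_pos this).ne'

omit [T2Space X] [CompactSpace X] in
/-- **The fibre function is negative at the lid**: `fib_y(c) < 0` for `g y < b`. [cite: GayKirby2016, §4, Lemma 14] -/
theorem fib_neg_at_c {y : B.Y} (hgy : B.g y < B.b) : T.fib y T.c < 0 := by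
  set G := B.g y - B.b with hG
  have hG0 : G < 0 := by rw [hG]; linarith
  have hwc : T.c - T.c - G = -G := by ring
  rw [fib_apply, hwc]
  have h1 : -G ≤ creaseσ T.ε (-G) := le_creaseσ T.ε_pos _
  have h2 : 0 < creaseStep (-G / T.ε) := creaseStep_pos (by
    have : 0 < -G / T.ε := div_pos (by linarith) T.ε_pos
    linarith)
  have h3 : 0 < (T.c - B.a) * creaseStep (-G / T.ε) := mul_pos (by linarith [T.band_le_c, B.U.δ_pos]) h2
  linarith

omit [T2Space X] [CompactSpace X] in
/-- **At a zero of the fibre function above `a`, `σ' > 0` and `m > 0`.** [folklore] -/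
theorem σcr_pos_of_fib_eq_zero {y : B.Y} (hgy : B.g y < B.b) {q : ℝ} (hq : B.a < q) (h0 : T.fib y q = 0) :
    0 < T.σcr (B.g y, q) ∧ 0 < T.mcr (B.g y, q) := by
  have hσ0 : 0 ≤ T.σcr (B.g y, q) := creaseStep_nonneg _
  have hfib : T.fib y q = T.mcr (B.g y, q) - (q - B.a) * T.σcr (B.g y, q) := rfl
  have hσpos : 0 < T.σcr (B.g y, q) := by
    rcases hσ0.eq_or_lt with hz | hpos
    · exfalso
      have hc0 := T.creaseσ_eq_zero_of_σcr_eq_zero hz.symm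
      have hm : T.mcr (B.g y, q) = -(B.g y - B.b) := by
        show -(B.g y - B.b) - creaseσ T.ε (T.wcr (B.g y, q)) = _; rw [hc0, sub_zero]
      rw [hfib, ← hz, mul_zero, sub_zero, hm] at h0
      linarith
    · exact hpos
  refine ⟨hσpos, ?_⟩
  have : T.mcr (B.g y, q) = (q - B.a) * T.σcr (B.g y, q) := by linarith
  rw [this]; exact mul_pos (by linarith) hσpos

omit [T2Space X] [CompactSpace X] in
/-- **The zero of the fibre function above `a` is unique.** [folklore] -/
theorem fib_eq_zero_unique {y : B.Y} (hgy : B.g y < B.b) {q₁ q₂ : ℝ} (h₁ : B.a < q₁) (h₂ : B.a < q₂)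
    (h0₁ : T.fib y q₁ = 0) (h0₂ : T.fib y q₂ = 0) : q₁ = q₂ := by
  by_contra hne
  wlog hlt : q₁ < q₂ generalizing q₁ q₂
  · exact this h₂ h₁ h0₂ h0₁ (Ne.symm hne) (lt_of_le_of_ne (not_lt.1 hlt) (Ne.symm hne))
  have hanti := T.fib_antitoneOn y
  have hzero : ∀ q ∈ Icc q₁ q₂, T.fib y q = 0 := by
    intro q hq
    have ha1 : T.fib y q ≤ T.fib y q₁ := hanti (mem_Ici.2 h₁.le) (mem_Ici.2 (h₁.le.trans hq.1)) hq.1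
    have ha2 : T.fib y q₂ ≤ T.fib y q := hanti (mem_Ici.2 (h₁.le.trans hq.1)) (mem_Ici.2 h₂.le) hq.2
    linarith
  set q := (q₁ + q₂) / 2 with hq
  have hqmem : q ∈ Ioo q₁ q₂ := ⟨by rw [hq]; linarith, by rw [hq]; linarith⟩
  have hev : T.fib y =ᶠ[𝓝 q] fun _ => (0 : ℝ) := by
    filter_upwards [Ioo_mem_nhds hqmem.1 hqmem.2] with r hr
    exact hzero r ⟨hr.1.le, hr.2.le⟩
  have hd0 : HasDerivAt (T.fib y) 0 q := (hasDerivAt_const q (0 : ℝ)).congr_of_eventuallyEq hev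
  have hd := T.hasDerivAt_fib y q
  have heq := hd.unique hd0
  have hqa : B.a < q := by rw [hq]; linarith
  obtain ⟨hσpos, -⟩ := T.σcr_pos_of_fib_eq_zero hgy hqa (hzero q ⟨hqmem.1.le, hqmem.2.le⟩)
  have h2 : 0 ≤ (q - B.a) * (deriv creaseStep ((q - T.c - (B.g y - B.b)) / T.ε) / T.ε) :=
    mul_nonneg (by linarith) (div_nonneg (deriv_creaseStep_nonneg _) T.ε_pos.le)
  linarith

namespace TubeFrame

namespace MidParams

variable {T} {ι : Type} [Fintype ι] {𝔉 : T.TubeFrame ι} (𝔔 : 𝔉.MidParams)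

omit [T2Space X] [CompactSpace X] in
/-- `∂₂Γ₂(g y, q) = w(g y) · fib_y(q)`. [folklore] -/
theorem fderiv_Γ₂_snd_eq (y : B.Y) (q : ℝ) : fderiv ℝ 𝔔.Γ₂ (B.g y, q) (0, 1) = 𝔔.w (B.g y) * T.fib y q :=
  (𝔔.Γ₂_partials (B.g y, q)).1

omit [T2Space X] [CompactSpace X] in
include 𝔔 in
/-- **The fibre function is positive on the band**: for `g y < b` and `a < q ≤ a + δ_U`
(by `4δ_U + 2ε ≤ c - a`). [cite: GayKirby2016, §4, Lemma 14] -/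
theorem fib_pos_of_band {y : B.Y} (hgy : B.g y < B.b) {q : ℝ} (hq1 : B.a < q) (hq2 : q ≤ B.a + B.U.δ) :
    0 < T.fib y q := by
  set G := B.g y - B.b with hG
  have hG0 : G < 0 := by rw [hG]; linarith
  set wcv := q - T.c - G with hwc
  have hwc' : T.wcr (B.g y, q) = wcv := rfl
  have hσ0 : 0 ≤ T.σcr (B.g y, q) := creaseStep_nonneg _
  have hσ1 : T.σcr (B.g y, q) ≤ 1 := creaseStep_le_one _
  have hfib : T.fib y q = -G - creaseσ T.ε wcv - (q - B.a) * T.σcr (B.g y, q) := rfl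
  have hδ := B.U.δ_pos
  have hε := T.ε_pos
  have h4 := 𝔔.band4
  rw [hfib]
  rcases hσ0.eq_or_lt with hz | hpos
  · have h0 : creaseσ T.ε wcv = 0 := by rw [← hwc']; exact T.creaseσ_eq_zero_of_σcr_eq_zero hz.symm
    rw [h0, ← hz]; linarith
  · have hwcε : -T.ε < wcv := by
      by_contra hle
      push Not at hle
      have : T.σcr (B.g y, q) = 0 := creaseStep_of_le_neg_one (by
        show T.wcr (B.g y, q) / T.ε ≤ -1
        rw [hwc', div_le_iff₀ T.ε_pos]; linarith)
      linarith
    have hle := creaseσ_le T.ε_pos wcv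
    have hterm : (q - B.a) * T.σcr (B.g y, q) ≤ q - B.a := mul_le_of_le_one_right (by linarith) hσ1
    rcases le_total wcv 0 with hw0 | hw0
    · rw [max_eq_right hw0] at hle; linarith
    · rw [max_eq_left hw0] at hle; linarith

omit [T2Space X] [CompactSpace X] in
include 𝔔 in
/-- **The fibre function vanishes somewhere between the band and the lid.** [cite: GayKirby2016, §4, Lemma 14] -/
theorem exists_fib_eq_zero {y : B.Y} (hgy : B.g y < B.b) : ∃ q, B.a + B.U.δ < q ∧ q < T.c ∧ T.fib y q = 0 := by
  have hle : B.a + B.U.δ ≤ T.c := T.band_le_c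
  have hpos := 𝔔.fib_pos_of_band hgy (by linarith [B.U.δ_pos]) le_rfl
  have hneg := T.fib_neg_at_c hgy
  obtain ⟨q, hq, h0⟩ := intermediate_value_Icc' hle (T.continuous_fib y).continuousOn ⟨hneg.le, hpos.le⟩
  refine ⟨q, lt_of_le_of_ne hq.1 fun h => ?_, lt_of_le_of_ne hq.2 fun h => ?_, h0⟩
  · rw [← h] at h0; linarith
  · rw [h] at h0; linarith

/-! ### The critical points of `ψ₂` in the flow-rule region -/

/-- **The critical points of `ψ₂` of index `i` in the flow-rule region** (interior points of `X₂`). [cite: GayKirby2016, §4, Lemma 14] -/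
def frCrit (i : ℕ) : Set X := {p | p ∈ 𝔔.FR ∧ p ∈ T.X₂ ∧ T.Mt p ≠ 0 ∧ p ∈ criticalSetOfIndex (𝓡 4) 𝔔.psiTwo i}

/-- Membership in `frCrit`. [folklore] -/
theorem mem_frCrit {i : ℕ} {p : X} : p ∈ 𝔔.frCrit i ↔
    p ∈ 𝔔.FR ∧ p ∈ T.X₂ ∧ T.Mt p ≠ 0 ∧ IsMCriticalPt (𝓡 4) 𝔔.psiTwo p ∧ morseIndex (𝓡 4) 𝔔.psiTwo p = i := by
  simp only [frCrit, mem_setOf_eq, mem_criticalSetOfIndex]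

/-- **A point of `frCrit` lands at a zero of its fibre function, on a critical point of `g`.** [cite: GayKirby2016, §4, Lemma 14] -/
theorem fib_eq_zero_of_mem_frCrit {i : ℕ} {p : X} (hp : p ∈ 𝔔.frCrit i) :
    T.fib (B.lamLift p) (B.f p) = 0 ∧ IsMCriticalPt (𝓡 3) B.g (B.lamLift p) := by
  obtain ⟨hFR, hx2, hM, hc, -⟩ := 𝔔.mem_frCrit.1 hp
  obtain ⟨h2, hcg⟩ := (𝔔.isMCriticalPt_psiTwo_iff_of_mem_FR hFR hx2 hM).1 hc
  rw [B.flowLift_eq_g_lamLift hFR.1, 𝔔.fderiv_Γ₂_snd_eq] at h2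
  rcases mul_eq_zero.1 h2 with h | h
  · exact absurd h (𝔔.w_pos _).ne'
  · exact ⟨h, hcg⟩

/-- **The landing point of a point of `frCrit` is off the thin tubes.**  Otherwise it would be an
axis point of an attaching circle (a critical point of `g` in the tube), the point would lie on
the core disc of that handle (the stable set of its centre); there `G ≤ -m₀`, the rounding is on
its plateau and the fibre function is `c + a - 2f`, so the point is at mid-height `f = (a + c)/2`,
at `A_j = η₂ - (c - a)/2 = (η₂ - ν²)/2 < a_R` — not in the flow-rule region. [cite: GayKirby2016, §4, Lemma 14] -/
theorem lamLift_not_mem_tubeNbhd_of_mem_frCrit (hεT : 0 < 𝔉.εT) {i : ℕ} {p : X} (hp : p ∈ 𝔔.frCrit i) (j : ι) :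
    B.lamLift p ∉ 𝔉.tubeNbhd j := by
  intro hy
  obtain ⟨hFR, hx2, hM, hc, -⟩ := 𝔔.mem_frCrit.1 hp
  obtain ⟨hh, hs, hA⟩ := hFR
  obtain ⟨h0, hcg⟩ := 𝔔.fib_eq_zero_of_mem_frCrit hp
  set y := B.lamLift p with hydef
  -- the plateau: `G = g y - b ≤ -m₀`, `w_c ≥ ε`, `σ' = 1`, `σ(w_c) = w_c`
  have hG : B.g y ≤ B.b - 𝔉.m₀ := 𝔉.g_margin j y hy.1 hy.2
  have hsdef : B.sFun p = B.f p - B.a := rfl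
  have hfa : B.a < B.f p := by linarith [T.D.χ₁.rOut_pos]
  have hwc : T.ε ≤ T.wcr (B.g y, B.f p) := by
    show T.ε ≤ B.f p - T.c - (B.g y - B.b)
    have := 𝔔.plateau; rw [𝔉.c_eq]; linarith [B.U.δ_pos]
  have hσ1 : T.σcr (B.g y, B.f p) = 1 :=
    creaseStep_of_one_le (by show 1 ≤ T.wcr (B.g y, B.f p) / T.ε; rw [le_div_iff₀ T.ε_pos]; linarith)
  have hσeq : creaseσ T.ε (T.wcr (B.g y, B.f p)) = T.wcr (B.g y, B.f p) := creaseσ_of_le T.ε_pos hwc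
  -- mid-height
  have hmid : B.f p = (B.a + T.c) / 2 := by
    have hfib : T.fib y (B.f p) = T.mcr (B.g y, B.f p) - (B.f p - B.a) * T.σcr (B.g y, B.f p) := rfl
    have hm : T.mcr (B.g y, B.f p) = -(B.g y - B.b) - creaseσ T.ε (T.wcr (B.g y, B.f p)) := rfl
    have hwcdef : T.wcr (B.g y, B.f p) = B.f p - T.c - (B.g y - B.b) := rfl
    rw [hfib, hm, hσeq, hσ1, hwcdef] at h0
    linarith
  -- `y` is an axis point: on the stable set of the centre; so is `p`
  have hyst : y.1 ∈ stableSet (𝓡 4) B.U.ξ (𝔉.boxes.cpt j) := 𝔉.mem_stableSet_of_isMCriticalPt_of_mem_tubeNbhd hεT hy hcg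
  obtain ⟨t, ht⟩ : ∃ t, flow B.U.contMDiff y.1 t = p := by
    have hyv : y.1 = levelProj B.U.contMDiff B.f B.a p := congrArg Subtype.val (B.lamLift_eq_mk_levelProj hh)
    rw [hyv]; exact mem_range_flow_levelProj B.U.contMDiff B.a p
  have hpst : p ∈ stableSet (𝓡 4) B.U.ξ (𝔉.boxes.cpt j) := by rw [← ht]; exact B.flow_mem_stableSet hyst t
  rw [stableSet_smul_eq 𝔉.hζ B.U.contMDiff 𝔉.U_eq 𝔉.continuous_ρU 𝔉.ρU_pos] at hpst
  -- Milnor's coordinates of `p`: `B_j = 0`, `A_j = a + η₂ - f p`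
  set η' := B.a + 𝔉.η₂ - B.f p with hη'
  have hη'pos : 0 < η' := by
    rw [hη', hmid, 𝔉.c_eq]; nlinarith [𝔉.two_nu_sq_le, 𝔉.ν_pos]
  have hη'lt : η' < (𝔉.boxes.box j).ε ^ 2 := by
    have := 𝔉.boxes.eta_lt j
    rw [hη']; linarith [𝔉.η₂_pos]
  have hfp : B.f p = B.f (𝔉.boxes.cpt j) - η' := by rw [𝔉.boxes.apply_cpt j, hη']; ring
  obtain ⟨hsrc, -, hAeq⟩ := MilnorBox.coord_of_mem_stableSet_of_apply_eq 𝔉.hζ 𝔉.hgl T.Fr.isMorse (𝔉.boxes.box j)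
    hη'pos hη'lt hpst hfp
  have hAval : 𝔉.boxes.A j p = η' := hAeq
  have hAgt := hA j hsrc
  -- `A_j p = (η₂ - ν²)/2 < a_R' < a_R`: contradiction
  have : η' = (𝔉.η₂ - 𝔉.ν ^ 2) / 2 := by rw [hη', hmid, 𝔉.c_eq]; ring
  linarith [𝔔.lt_aR', 𝔔.aR'_lt]

/-- **The landing point of a point of `frCrit_i` lies in `critY_i`.** [cite: GayKirby2016, §4, Lemma 14] -/
theorem lamLift_mem_critY_of_mem_frCrit (hgM : IsMorse (𝓡 3) B.g) (hεT : 0 < 𝔉.εT) {i : ℕ} {p : X}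
    (hp : p ∈ 𝔔.frCrit i) : B.lamLift p ∈ 𝔉.critY i := by
  obtain ⟨hFR, hx2, hM, hc, hidx⟩ := 𝔔.mem_frCrit.1 hp
  obtain ⟨-, hcg⟩ := 𝔔.fib_eq_zero_of_mem_frCrit hp
  obtain ⟨-, hidx'⟩ := 𝔔.morseData_psiTwo_of_mem_FR hgM hFR hx2 hM hc
  refine (𝔉.mem_critY).2 ⟨⟨hcg, ?_⟩, T.g_lamLift_lt_b hx2 hFR.1 hM, 𝔔.lamLift_not_mem_tubeNbhd_of_mem_frCrit hεT hp⟩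
  rw [← hidx', hidx]

/-- **The landing map is injective on `⋃ᵢ frCrit_i`** (two critical points over the same level
point lie at the unique zero of its fibre function, on one trajectory). [cite: MilnorHCobordism1965, Thm. 4.1] -/
theorem lamLift_injOn_frCrit {i i' : ℕ} {p p' : X} (hp : p ∈ 𝔔.frCrit i) (hp' : p' ∈ 𝔔.frCrit i')
    (h : B.lamLift p = B.lamLift p') : p = p' := by
  obtain ⟨⟨hh, hs, -⟩, hx2, hM, -, -⟩ := 𝔔.mem_frCrit.1 hp
  obtain ⟨⟨hh', hs', -⟩, -, -, -, -⟩ := 𝔔.mem_frCrit.1 hp'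
  obtain ⟨h0, -⟩ := 𝔔.fib_eq_zero_of_mem_frCrit hp
  obtain ⟨h0', -⟩ := 𝔔.fib_eq_zero_of_mem_frCrit hp'
  set y := B.lamLift p with hy
  have hgy : B.g y < B.b := T.g_lamLift_lt_b hx2 hh hM
  rw [← h] at h0'
  have hsdef : B.sFun p = B.f p - B.a := rfl
  have hsdef' : B.sFun p' = B.f p' - B.a := rfl
  have hff : B.f p = B.f p' :=
    T.fib_eq_zero_unique hgy (by linarith [T.D.χ₁.rOut_pos]) (by linarith [T.D.χ₁.rOut_pos]) h0 h0'
  -- same trajectory, same height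
  have hyv : y.1 = levelProj B.U.contMDiff B.f B.a p := congrArg Subtype.val (B.lamLift_eq_mk_levelProj hh)
  have hyv' : y.1 = levelProj B.U.contMDiff B.f B.a p' := by
    have h1 := congrArg Subtype.val (B.lamLift_eq_mk_levelProj hh')
    rw [← h] at h1
    exact h1
  obtain ⟨t, ht⟩ : ∃ t, flow B.U.contMDiff y.1 t = p := by
    rw [hyv]; exact mem_range_flow_levelProj B.U.contMDiff B.a p
  obtain ⟨t', ht'⟩ : ∃ t, flow B.U.contMDiff y.1 t = p' := by
    rw [hyv']; exact mem_range_flow_levelProj B.U.contMDiff B.a p'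
  have hyc : ¬ IsMCriticalPt (𝓡 4) B.f y.1 := B.not_isMCriticalPt_of_apply_eq_a y.2
  have hmono : StrictMono (B.f ∘ flow B.U.contMDiff y.1) :=
    T.Fr.isGradientLike.strictMono_comp_flow T.Fr.isMorse B.U.contMDiff hyc
  have htt : t = t' := hmono.injective (by
    show B.f (flow B.U.contMDiff y.1 t) = B.f (flow B.U.contMDiff y.1 t')
    rw [ht, ht', hff])
  rw [← ht, ← ht', htt]

/-- **Over every point of `critY_i` there is a point of `frCrit_i`** (flow the level point up to
the zero of its fibre function). [cite: GayKirby2016, §4, Lemma 14] -/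
theorem exists_mem_frCrit_of_mem_critY (hgM : IsMorse (𝓡 3) B.g) {i : ℕ} {y : B.Y} (hy : y ∈ 𝔉.critY i) :
    ∃ p ∈ 𝔔.frCrit i, B.lamLift p = y := by
  obtain ⟨⟨hcg, hidx⟩, hgb, hnt⟩ := (𝔉.mem_critY).1 hy
  obtain ⟨qs, hq1, hq2, h0⟩ := 𝔔.exists_fib_eq_zero hgb
  obtain ⟨tc, htc⟩ := 𝔉.exists_f_flow_eq_c_of_mem_critY hy
  have hy0 : B.Hit y.1 := B.hit_of_apply_eq y.2
  have hyc : ¬ IsMCriticalPt (𝓡 4) B.f y.1 := B.not_isMCriticalPt_of_apply_eq_a y.2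
  have hmono : StrictMono (B.f ∘ flow B.U.contMDiff y.1) :=
    T.Fr.isGradientLike.strictMono_comp_flow T.Fr.isMorse B.U.contMDiff hyc
  have hfy : B.f (flow B.U.contMDiff y.1 0) = B.a := by rw [flow_zero]; exact y.2
  have htc0 : 0 ≤ tc := by
    by_contra hlt
    push Not at hlt
    have h := hmono hlt
    simp only [comp_apply, htc, hfy] at h
    linarith [T.band_le_c, B.U.δ_pos]
  -- intermediate value: the height `qs` is reached
  have hcont : ContinuousOn (fun t => B.f (flow B.U.contMDiff y.1 t)) (Icc 0 tc) :=
    (B.U.contMDiff_f.continuous.comp (continuous_flow B.U.contMDiff y.1)).continuousOn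
  have hmem : qs ∈ Icc (B.f (flow B.U.contMDiff y.1 0)) (B.f (flow B.U.contMDiff y.1 tc)) := by
    rw [hfy, htc]; exact ⟨by linarith [B.U.δ_pos], hq2.le⟩
  obtain ⟨ts, -, hts⟩ := intermediate_value_Icc htc0 hcont hmem
  set p := B.U.fl y.1 ts with hpdef
  have hfp : B.f p = qs := hts
  have hh : B.Hit p := B.hit_fl hy0 ts
  have hlam : B.lamLift p = y := T.lamLift_fl_level y ts
  have hsdef : B.sFun p = B.f p - B.a := rfl
  have hs : T.D.χ₁.rOut < B.sFun p := by rw [hsdef, hfp]; linarith [T.D.rOut₁_lt]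
  have hF₁ : T.D.F₁ p = B.sFun p := T.F₁_eq_sFun_of_lt hs
  have hx₁ : p ∉ T.X₁ := fun h1 => by
    have := T.D.sFun_nonpos_of_mem_sector h1
    linarith [T.D.χ₁.rOut_pos]
  -- `G = g y - b`, `M = -m(g y, qs) < 0`
  have hφ : flowLift B.U.contMDiff B.hf B.g p = B.g y := by rw [B.flowLift_eq_g_lamLift hh, hlam]
  obtain ⟨-, hmpos⟩ := T.σcr_pos_of_fib_eq_zero hgb (by linarith [B.U.δ_pos] : B.a < qs) h0
  have hMval : T.M p = -T.mcr (B.g y, qs) := by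
    have h := T.mcr_eq_neg_M hh
    rw [hφ, hfp] at h
    linarith
  have hMneg : T.M p < 0 := by rw [hMval]; linarith
  have hx2 : p ∈ T.X₂ := (T.mem_X₂_iff_of_hit hh hx₁).2 hMneg.le
  have hMt : T.Mt p ≠ 0 := by rw [T.Mt_of_hit hh]; exact hMneg.ne
  obtain ⟨hf₁, hf₂⟩ := 𝔉.f_bounds_of_mem_X₂ hx2
  -- the flow-rule region: off the columns, since `y` is off the thin tubes
  have hFR : p ∈ 𝔔.FR := by
    refine ⟨hh, hs, fun j hsrc => ?_⟩
    by_contra hle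
    push Not at hle
    have hP : 𝔉.boxes.P j p < 𝔉.P₀ := by
      have hA0 := 𝔉.boxes.A_nonneg j p
      have hB0 := 𝔉.boxes.B_nonneg j p
      have hB : 𝔉.boxes.B j p < 𝔉.ν ^ 2 + 𝔉.boxes.A j p := by
        have h := 𝔉.boxes.apply_eq hsrc
        have hfc : B.f p < T.c := by rw [hfp]; exact hq2
        rw [𝔉.c_eq] at hfc
        linarith
      rw [HandleBoxes.P_def]
      calc 𝔉.boxes.A j p * 𝔉.boxes.B j p ≤ 𝔉.boxes.A j p * (𝔉.ν ^ 2 + 𝔉.boxes.A j p) :=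
            mul_le_mul_of_nonneg_left hB.le hA0
        _ ≤ 𝔔.aR * (𝔉.ν ^ 2 + 𝔔.aR) := by nlinarith [𝔉.ν_pos, 𝔔.aR_pos]
        _ < 2 * 𝔔.aR * (𝔉.ν ^ 2 + 2 * 𝔔.aR) := by nlinarith [𝔉.ν_pos, 𝔔.aR_pos]
        _ ≤ 𝔉.P₀ := 𝔔.col_P
    have htube := 𝔉.lamLift_mem_tubeNbhd hsrc hP hf₁ hf₂ hh
    rw [hlam] at htube
    exact hnt j htube
  -- criticality and index
  have hcrit : IsMCriticalPt (𝓡 4) 𝔔.psiTwo p := by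
    refine (𝔔.isMCriticalPt_psiTwo_iff_of_mem_FR hFR hx2 hMt).2 ⟨?_, by rw [hlam]; exact hcg⟩
    rw [hφ, hfp, 𝔔.fderiv_Γ₂_snd_eq, h0, mul_zero]
  obtain ⟨-, hidx'⟩ := 𝔔.morseData_psiTwo_of_mem_FR hgM hFR hx2 hMt hcrit
  refine ⟨p, 𝔔.mem_frCrit.2 ⟨hFR, hx2, hMt, hcrit, ?_⟩, hlam⟩
  rw [hidx', hlam]; exact hidx

/-- **The number of critical points of `ψ₂` of index `i` in the flow-rule region is the number of
critical points of `g` of index `i` below `b` off the thin tubes.** [cite: GayKirby2016, §4, Lemma 14] -/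
theorem ncard_frCrit_eq (hgM : IsMorse (𝓡 3) B.g) (hεT : 0 < 𝔉.εT) (i : ℕ) :
    (𝔔.frCrit i).ncard = (𝔉.critY i).ncard := by
  have himage : B.lamLift '' 𝔔.frCrit i = 𝔉.critY i := by
    ext y
    constructor
    · rintro ⟨p, hp, rfl⟩
      exact 𝔔.lamLift_mem_critY_of_mem_frCrit hgM hεT hp
    · intro hy
      obtain ⟨p, hp, hpy⟩ := 𝔔.exists_mem_frCrit_of_mem_critY hgM hy
      exact ⟨p, hp, hpy⟩
  have hinj : Set.InjOn B.lamLift (𝔔.frCrit i) := fun p hp p' hp' h => 𝔔.lamLift_injOn_frCrit hp hp' h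
  rw [← himage, hinj.ncard_image]

/-- For `i` such that `g` has no critical point of index `i` below `b`, `frCrit_i = ∅`. [cite: GayKirby2016, §4, Lemma 14] -/
theorem frCrit_eq_empty (hgM : IsMorse (𝓡 3) B.g) (hεT : 0 < 𝔉.εT)
    (hidx : ∀ y, IsMCriticalPt (𝓡 3) B.g y → B.g y < B.b → morseIndex (𝓡 3) B.g y ≤ 1) {i : ℕ} (hi : 2 ≤ i) :
    𝔔.frCrit i = ∅ := by
  ext p
  simp only [mem_empty_iff_false, iff_false]
  intro hp
  obtain ⟨⟨hcg, hidx'⟩, hgb, -⟩ := (𝔉.mem_critY).1 (𝔔.lamLift_mem_critY_of_mem_frCrit hgM hεT hp)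
  have := hidx _ hcg hgb
  omega

end MidParams

end TubeFrame

end TriData

end BiCollar

end Literature.Topology.FourManifolds

end

/-!
# The handle decomposition of the straightened middle sector `X₂` (Gay–Kirby 2016, Lemma 14:
# "`X₂ ≅ ♮ᵏ S¹ × B³`")

Topic `Literature/Topology/FourManifolds`; for the fact seat
`provefact-Literature.Topology.FourManifolds.exists_isBalancedGKTrisection` (Gay–Kirby 2016,
Thm. 4 via §4, Lemma 14).  Everything in this file is **proved**; no named facts are introduced.

Gay–Kirby, proof of Lemma 14: *"`X₂` is diffeomorphic to `♮ᵏ S¹ × B³` because the `2`-handles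
cancel `g - k` of the `S¹ × B³`'s of `[0, ε] × H₁₂ = ♮ᵍ S¹ × B³`"*.  For the sector
`X₂ = TriData.X₂` with its straightened structure `TriData.cornerSliceAtlas₂` (corners along `F`,
faces the bevel face `X₂ ∩ X₁` and `H₂₃ = X₂ ∩ X₃`) we feed the adapted function
`ψ₂ = MidParams.psiTwo` (`TrisectionsMidSectorFunction/Band/Column/FlowRule.lean` and the fibre analysis above) into
`CornerSliceAtlas.hasHandleDecomposition_of_comp_val` (`TrisectionsSectorMorse.lean`).  Its
interior critical points (`image_interior_inter_criticalSetOfIndex`): a critical point is off the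
unit band (there `ψ₂` decreases strictly along the flow), hence lies in the flow-rule region — one
critical point over each critical point of `g` in `H₁₂ = {g < b}` off the thin tubes, of the same
index — or in a handle column — the centre `c_j` of the handle, of index `0`.  Result:
`MidParams.hasHandleDecomposition_X₂` — **`HasHandleDecomposition 3 ↥X₂ c` with
`c 0 = #critY₀ + m`, `c 1 = #critY₁`, `c i = #critYᵢ` (`m` the number of `2`-handles)** —, the
connectedness of `↥X₂` (`connectedSpace_X₂`: a clopen part missing the two faces would carry an
interior maximum of `ψ₂`, a critical point of index `4`), and the normal form
`MidParams.exists_hasHandleDecomposition_X₂_handleCount`: **`X₂` has a handle decomposition with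
one `0`-handle and `k₂` `1`-handles** for some `k₂` (Milnor 1965, Thm. 8.1: the surplus
`0`-handles cancel), the hypothesis `h₂` of `isGKTrisection_of_handles`.

## References

* D. Gay, R. Kirby, *Trisecting 4-manifolds*, Geom. Topol. 20 (2016) 3097–3132
  (arXiv:1205.1565): §4, Lemma 14 and its proof. [GayKirby2016]
* J. Milnor, *Morse theory* (1963), Thm. 3.1 and §3. [Milnor1963]
* J. Milnor, *Lectures on the h-cobordism theorem* (1965), Thm. 8.1. [MilnorHCobordism1965]
-/

open scoped Manifold ContDiff Topology
open Set Function Filter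

noncomputable section

universe u

namespace Literature.Topology.FourManifolds

open Flow

variable {X : Type u} [TopologicalSpace X] [T2Space X] [CompactSpace X]
  [ChartedSpace (EuclideanSpace ℝ (Fin 4)) X] [IsManifold (𝓡 4) ∞ X]

namespace BiCollar

namespace TriData

namespace TubeFrame

namespace MidParams

variable {B : BiCollar X} {T : B.TriData} {ι : Type} [Fintype ι] {𝔉 : T.TubeFrame ι} (𝔔 : 𝔉.MidParams)

/-! ### Where the interior critical points are -/

/-- **A critical point of `ψ₂` at an interior point of `X₂` lies above the unit band** (`s ≥ δ_U`). [cite: GayKirby2016, §4, Lemma 14] -/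
theorem δ_le_sFun_of_isMCriticalPt {p : X} (hx2 : p ∈ T.X₂) (h0 : T.D.F₁ p ≠ 0) (hM : T.Mt p ≠ 0)
    (hc : IsMCriticalPt (𝓡 4) 𝔔.psiTwo p) : B.U.δ ≤ B.sFun p := by
  by_contra hlt
  push Not at hlt
  have hs := T.sFun_gt_of_mem_X₂ hx2
  exact 𝔔.not_isMCriticalPt_psiTwo_of_band (abs_lt.2 ⟨hs, hlt⟩) hx2 h0 hM hc

/-- **An interior critical point of `ψ₂` lies in the flow-rule region or in a handle column.** [cite: GayKirby2016, §4, Lemma 14] -/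
theorem mem_FR_or_exists_mem_col {p : X} (hx2 : p ∈ T.X₂) (h0 : T.D.F₁ p ≠ 0) (hM : T.Mt p ≠ 0)
    (hc : IsMCriticalPt (𝓡 4) 𝔔.psiTwo p) : p ∈ 𝔔.FR ∨ ∃ j, p ∈ 𝔔.col j := by
  have hs := 𝔔.δ_le_sFun_of_isMCriticalPt hx2 h0 hM hc
  have hs' : T.D.χ₁.rOut < B.sFun p := T.D.rOut₁_lt.trans_le hs
  obtain ⟨hf₁, hf₂⟩ := 𝔉.f_bounds_of_mem_X₂ hx2
  have hsdef : B.sFun p = B.f p - B.a := rfl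
  have hfc := T.f_le_c_of_mem_X₂ hx2
  by_cases hj : ∃ j, p ∈ (𝔉.boxes.box j).chart.source ∧ 𝔉.boxes.A j p ≤ 𝔔.aR
  · obtain ⟨j, hsrc, hA⟩ := hj
    right
    refine ⟨j, hsrc, by linarith [𝔔.aR_pos], by linarith [B.U.δ_pos], lt_of_le_of_ne hfc fun hfe => hM ?_⟩
    -- with `f p = c` the plateau gives `M̃ = 0`
    have hP : 𝔉.boxes.P j p < 𝔉.P₀ := by
      have hA0 := 𝔉.boxes.A_nonneg j p
      have hB0 := 𝔉.boxes.B_nonneg j p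
      have hB : 𝔉.boxes.B j p ≤ 𝔉.ν ^ 2 + 𝔉.boxes.A j p := by
        have h := 𝔉.boxes.apply_eq hsrc
        rw [𝔉.c_eq] at hfc; linarith
      rw [HandleBoxes.P_def]
      calc 𝔉.boxes.A j p * 𝔉.boxes.B j p ≤ 𝔉.boxes.A j p * (𝔉.ν ^ 2 + 𝔉.boxes.A j p) :=
          mul_le_mul_of_nonneg_left hB hA0
        _ ≤ 𝔔.aR * (𝔉.ν ^ 2 + 𝔔.aR) := by nlinarith [𝔉.ν_pos, 𝔔.aR_pos]
        _ < 2 * 𝔔.aR * (𝔉.ν ^ 2 + 2 * 𝔔.aR) := by nlinarith [𝔉.ν_pos, 𝔔.aR_pos]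
        _ ≤ 𝔉.P₀ := 𝔔.col_P
    have h := (𝔉.Mt_eventuallyEq_sub_of_P_lt 𝔔.plateau hsrc hP (by linarith [B.U.δ_pos]) hf₂).self_of_nhds
    rw [h]
    show B.f p - T.c = 0
    rw [hfe, sub_self]
  · push Not at hj
    left
    refine ⟨?_, hs', fun j hsrc => hj j hsrc⟩
    by_contra hh
    obtain ⟨j, hsrc, hA0⟩ := 𝔉.exists_A_eq_zero_of_not_hit hf₁ hf₂ hh
    have := hj j hsrc
    rw [hA0] at this
    linarith [𝔔.aR_pos]

/-- Points of the flow-rule region are off the surface and off the bevel face. [folklore] -/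
theorem F₁_pos_of_mem_FR {p : X} (hp : p ∈ 𝔔.FR) : 0 < T.D.F₁ p := by
  rw [T.F₁_eq_sFun_of_lt hp.2.1]; exact T.D.χ₁.rOut_pos.trans hp.2.1

/-! ### The interior critical set of `ψ₂` -/

section Interior

variable (hgM : IsMorse (𝓡 3) B.g) (hεT : 0 < 𝔉.εT)

/-- **The interior critical points of `ψ₂` of index `i`**: the flow-rule critical points of index
`i`, together with the centres of the `2`-handles if `i = 0`. [cite: GayKirby2016, §4, Lemma 14] -/
theorem image_interior_inter_criticalSetOfIndex (i : ℕ) :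
    letI := (T.cornerSliceAtlas₂ 𝔔.hc2 𝔉.two_mul_ε_le 𝔉.linkCondition).chartedSpace
    (Subtype.val : T.X₂ → X) '' ((𝓡∂ 4).interior T.X₂) ∩ criticalSetOfIndex (𝓡 4) 𝔔.psiTwo i =
      𝔔.frCrit i ∪ (if i = 0 then range 𝔉.boxes.cpt else ∅) := by
  letI := (T.cornerSliceAtlas₂ 𝔔.hc2 𝔉.two_mul_ε_le 𝔉.linkCondition).chartedSpace
  ext p
  simp only [mem_inter_iff, mem_image, mem_union]
  constructor
  · rintro ⟨⟨q, hq, rfl⟩, hci⟩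
    have hint : (𝓡∂ 4).IsInteriorPoint q := hq
    obtain ⟨hps, h0, hM⟩ := (T.isInteriorPoint_iff₂ 𝔔.hc2 𝔉.two_mul_ε_le 𝔉.linkCondition q).1 hint
    obtain ⟨hc, hidx⟩ := mem_criticalSetOfIndex.1 hci
    rcases 𝔔.mem_FR_or_exists_mem_col q.2 h0 hM hc with hFR | ⟨j, hcol⟩
    · exact Or.inl (𝔔.mem_frCrit.2 ⟨hFR, q.2, hM, hc, hidx⟩)
    · have hq' : q.1 = 𝔉.boxes.cpt j := 𝔔.eq_cpt_of_isMCriticalPt_psiTwo_of_mem_col hcol hc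
      obtain ⟨-, -, hidx0⟩ := 𝔔.morseData_psiTwo_cpt j
      have hi : i = 0 := by rw [← hidx, hq', hidx0]
      subst hi
      rw [if_pos rfl]
      exact Or.inr ⟨j, hq'.symm⟩
  · rintro (hp | hp)
    · obtain ⟨hFR, hx2, hM, hc, hidx⟩ := 𝔔.mem_frCrit.1 hp
      have hF := 𝔔.F₁_pos_of_mem_FR hFR
      have hps : p ∉ B.surface := fun hs => hF.ne' (T.D.F₁_eq_zero_of_mem_surface hs)
      exact ⟨⟨⟨p, hx2⟩, (T.isInteriorPoint_iff₂ 𝔔.hc2 𝔉.two_mul_ε_le 𝔉.linkCondition ⟨p, hx2⟩).2 ⟨hps, hF.ne', hM⟩, rfl⟩,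
        mem_criticalSetOfIndex.2 ⟨hc, hidx⟩⟩
    · by_cases hi : i = 0
      · subst hi
        rw [if_pos rfl] at hp
        obtain ⟨j, rfl⟩ := hp
        obtain ⟨hcrit, -, hidx0⟩ := 𝔔.morseData_psiTwo_cpt j
        exact ⟨⟨⟨_, 𝔔.cpt_mem_X₂ j⟩, (T.isInteriorPoint_iff₂ 𝔔.hc2 𝔉.two_mul_ε_le 𝔉.linkCondition _).2 (𝔔.cpt_interior j), rfl⟩,
          mem_criticalSetOfIndex.2 ⟨hcrit, hidx0⟩⟩
      · rw [if_neg hi] at hp; exact absurd hp (notMem_empty _)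

omit [T2Space X] [CompactSpace X] in
/-- The centres of the boxes are pairwise distinct. [folklore] -/
theorem _root_.Literature.Topology.FourManifolds.BiCollar.TriData.TubeFrame.cpt_injective (𝔉 : T.TubeFrame ι) :
    Injective 𝔉.boxes.cpt := fun i j h => by
  by_contra hij
  exact (𝔉.boxes.disjoint hij).le_bot ⟨(𝔉.boxes.box i).mem_source, by rw [h]; exact (𝔉.boxes.box j).mem_source⟩

/-- No centre lies in the flow-rule region (the centres do not hit the level). [folklore] -/
theorem cpt_not_mem_frCrit (i : ℕ) (j : ι) : 𝔉.boxes.cpt j ∉ 𝔔.frCrit i := fun h =>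
  𝔉.not_hit_cpt j (𝔔.mem_frCrit.1 h).1.1

include hgM hεT in
/-- `frCrit_i` is finite (it injects into the finite critical set of `g`). [folklore] -/
theorem finite_frCrit (i : ℕ) : (𝔔.frCrit i).Finite := by
  have hfin : (criticalSet (𝓡 3) B.g).Finite := IsMorse.finite_criticalSet_holds hgM
  have h1 : (𝔉.critY i).Finite := hfin.subset fun y hy => hy.1.1
  have himg : B.lamLift '' 𝔔.frCrit i ⊆ 𝔉.critY i := by
    rintro y ⟨p, hp, rfl⟩; exact 𝔔.lamLift_mem_critY_of_mem_frCrit hgM hεT hp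
  exact Set.Finite.of_finite_image (h1.subset himg) fun p hp p' hp' h => 𝔔.lamLift_injOn_frCrit hp hp' h

/-- **The count of interior critical points of `ψ₂` of index `i`**: `#critYᵢ`, plus the number
`m` of `2`-handles if `i = 0`. [cite: GayKirby2016, §4, Lemma 14] -/
def _root_.Literature.Topology.FourManifolds.BiCollar.TriData.TubeFrame.countMid (𝔉 : T.TubeFrame ι) (i : ℕ) : ℕ :=
  (𝔉.critY i).ncard + (if i = 0 then Fintype.card ι else 0)

include hgM hεT in
/-- The count of interior critical points of index `i` is `countMid i`. [cite: GayKirby2016, §4, Lemma 14] -/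
theorem ncard_interior_inter_criticalSetOfIndex (i : ℕ) :
    letI := (T.cornerSliceAtlas₂ 𝔔.hc2 𝔉.two_mul_ε_le 𝔉.linkCondition).chartedSpace
    ((Subtype.val : T.X₂ → X) '' ((𝓡∂ 4).interior T.X₂) ∩ criticalSetOfIndex (𝓡 4) 𝔔.psiTwo i).ncard = 𝔉.countMid i := by
  rw [𝔔.image_interior_inter_criticalSetOfIndex i, TubeFrame.countMid, ← 𝔔.ncard_frCrit_eq hgM hεT i]
  by_cases hi : i = 0
  · subst hi
    rw [if_pos rfl, if_pos rfl]
    have hdisj : Disjoint (𝔔.frCrit 0) (range 𝔉.boxes.cpt) :=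
      Set.disjoint_left.2 fun p hp ⟨j, hj⟩ => 𝔔.cpt_not_mem_frCrit 0 j (hj ▸ hp)
    rw [ncard_union_eq hdisj (𝔔.finite_frCrit hgM hεT 0) (finite_range _), ← image_univ,
      ncard_image_of_injective _ 𝔉.cpt_injective, ncard_univ, Nat.card_eq_fintype_card]
  · rw [if_neg hi, if_neg hi, union_empty, add_zero]

end Interior

/-! ### The corner form of `ψ₂` on the bi-collar box -/

/-- The outer function of the corner form: `G(y) = 1 - (C w(b)/2) y₀`, so that
`G ∘ cornerFold = 1 - C w(b) uv`. [folklore] -/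
def cornerG (𝔔 : 𝔉.MidParams) (y : EuclideanSpace ℝ (Fin 4)) : ℝ := 1 - (𝔔.C * 𝔔.w B.b / 2) * y 0

omit [T2Space X] [CompactSpace X] in
/-- `G` is smooth. [folklore] -/
theorem contDiff_cornerG : ContDiff ℝ ∞ 𝔔.cornerG :=
  contDiff_const.sub (contDiff_const.mul (EuclideanSpace.proj (0 : Fin 4) : EuclideanSpace ℝ (Fin 4) →L[ℝ] ℝ).contDiff)

omit [T2Space X] [CompactSpace X] in
/-- `dG ≠ 0`. [folklore] -/
theorem fderiv_cornerG_ne_zero (y : EuclideanSpace ℝ (Fin 4)) : fderiv ℝ 𝔔.cornerG y ≠ 0 := by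
  have hκ : 0 < 𝔔.C * 𝔔.w B.b / 2 := by have := 𝔔.C_pos; have := 𝔔.w_pos B.b; positivity
  have h : HasFDerivAt 𝔔.cornerG (-((𝔔.C * 𝔔.w B.b / 2) • (EuclideanSpace.proj (0 : Fin 4) : EuclideanSpace ℝ (Fin 4) →L[ℝ] ℝ))) y := by
    have := ((EuclideanSpace.proj (0 : Fin 4) : EuclideanSpace ℝ (Fin 4) →L[ℝ] ℝ).hasFDerivAt (x := y)).const_mul (𝔔.C * 𝔔.w B.b / 2)
    exact this.const_sub 1
  rw [h.fderiv]
  intro h0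
  have h1 := congrArg (fun L : EuclideanSpace ℝ (Fin 4) →L[ℝ] ℝ => L (EuclideanSpace.single (0 : Fin 4) (1 : ℝ))) h0
  simp at h1
  rcases h1 with h1 | h1
  · exact 𝔔.C_pos.ne' h1
  · exact (𝔔.w_pos B.b).ne' h1

/-- **On the bi-collar box, `ψ₂ = G(cornerFold(Θ q))` in the corner-slice chart of `X₂`.** [cite: GayKirby2016, Def. 1 and Fig. 1] -/
theorem psiTwo_eq_cornerG {p : X} {q : X} (hq : q ∈ (T.cornerSliceChart₂ p).Θ.source) :
    𝔔.psiTwo q = 𝔔.cornerG (cornerFold ((T.cornerSliceChart₂ p).Θ q)) := by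
  have hqb : q ∈ B.box T.D.εw := by
    change q ∈ B.wedgeSource (chartAt (EuclideanSpace ℝ (Fin 2)) (B.zL p)) T.D.εw at hq
    exact hq.1
  rw [cornerG, cornerFold_apply_zero, (T.cornerSliceChart₂ p).apply_zero q hq, (T.cornerSliceChart₂ p).apply_one q hq, psiTwo,
    𝔔.PsiTwo_of_mem_box hqb]
  ring

/-! ### The handle decomposition -/

section Handles

variable (hgM : IsMorse (𝓡 3) B.g) (hεT : 0 < 𝔉.εT)

include hgM hεT in
/-- **The handle decomposition of the straightened middle sector**: one handle of index `i` per
critical point of `g` of index `i` in `H₁₂ = {g < b}` off the thin tubes, and one `0`-handle per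
`2`-handle of `f` (Gay–Kirby: "`X₂ ≅ ♮ᵏ S¹ × B³`", the `2`-handles cancelling `1`-handles of
`[0, ε] × H₁₂`; here as the raw count before cancellation). [cite: GayKirby2016, §4, Lemma 14] [cite: Milnor1963, Thm. 3.1] -/
theorem hasHandleDecomposition_X₂ :
    letI := (T.cornerSliceAtlas₂ 𝔔.hc2 𝔉.two_mul_ε_le 𝔉.linkCondition).chartedSpace
    HasHandleDecomposition 3 T.X₂ 𝔉.countMid := by
  letI := (T.cornerSliceAtlas₂ 𝔔.hc2 𝔉.two_mul_ε_le 𝔉.linkCondition).chartedSpace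
  set Φ := T.cornerSliceAtlas₂ 𝔔.hc2 𝔉.two_mul_ε_le 𝔉.linkCondition with hΦ
  refine Φ.hasHandleDecomposition_of_comp_val (F := 𝔔.psiTwo)
    (fun q hq _ => 𝔔.contMDiffAt_psiTwo hq) (fun p hp => ?_) (fun p hb => ?_) (fun p hb hpK => ?_)
    (fun p hi => ?_) (fun p hi hc => ?_) (fun i => 𝔔.ncard_interior_inter_criticalSetOfIndex hgM hεT i)
  · -- corner form
    exact ⟨𝔔.cornerG, 𝔔.contDiff_cornerG.contDiffAt, 𝔔.fderiv_cornerG_ne_zero _, fun q hq _ => 𝔔.psiTwo_eq_cornerG hq⟩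
  · -- `= 1` on the boundary
    exact 𝔔.psiTwo_eq_one_of_boundary 𝔔.hc2 p.2 ((T.isBoundaryPoint_iff₂' 𝔔.hc2 𝔉.two_mul_ε_le 𝔉.linkCondition p).1 hb)
  · -- regular on the boundary off `F`
    rcases (T.isBoundaryPoint_iff₂' 𝔔.hc2 𝔉.two_mul_ε_le 𝔉.linkCondition p).1 hb with h | h0 | hM
    · exact absurd h hpK
    · exact 𝔔.not_isMCriticalPt_psiTwo_of_F₁_eq_zero p.2 h0 hpK
    · by_cases h0 : T.D.F₁ p.1 = 0
      · exact 𝔔.not_isMCriticalPt_psiTwo_of_F₁_eq_zero p.2 h0 hpK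
      · exact 𝔔.not_isMCriticalPt_psiTwo_of_Mt_eq_zero p.2 h0 hM
  · -- `< 1` inside
    obtain ⟨-, h0, hM⟩ := (T.isInteriorPoint_iff₂ 𝔔.hc2 𝔉.two_mul_ε_le 𝔉.linkCondition p).1 hi
    exact 𝔔.psiTwo_lt_one_of_interior 𝔔.hc2 p.2 h0 hM
  · -- nondegenerate at interior critical points
    obtain ⟨-, h0, hM⟩ := (T.isInteriorPoint_iff₂ 𝔔.hc2 𝔉.two_mul_ε_le 𝔉.linkCondition p).1 hi
    rcases 𝔔.mem_FR_or_exists_mem_col p.2 h0 hM hc with hFR | ⟨j, hcol⟩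
    · exact (𝔔.morseData_psiTwo_of_mem_FR hgM hFR p.2 hM hc).1
    · have hq : p.1 = 𝔉.boxes.cpt j := 𝔔.eq_cpt_of_isMCriticalPt_psiTwo_of_mem_col hcol hc
      rw [hq]; exact (𝔔.morseData_psiTwo_cpt j).2.1

/-! ### Connectedness of `X₂` and the normal form -/

include 𝔔 hgM hεT in
/-- **No interior critical point of `ψ₂` has index `≥ 2`** when the critical points of `g` below
`b` have index `≤ 1`. [cite: GayKirby2016, §4, Lemma 14] -/
theorem countMid_eq_zero (hidx : ∀ y, IsMCriticalPt (𝓡 3) B.g y → B.g y < B.b → morseIndex (𝓡 3) B.g y ≤ 1)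
    {i : ℕ} (hi : 2 ≤ i) : 𝔉.countMid i = 0 := by
  rw [TubeFrame.countMid, if_neg (by omega), add_zero, ← 𝔔.ncard_frCrit_eq hgM hεT i, 𝔔.frCrit_eq_empty hgM hεT hidx hi, ncard_empty]

include 𝔔 hgM hεT in
/-- **`X₂` is connected** provided its two faces `X₂ ∩ X₁` and `X₂ ∩ X₃` are connected and the
critical points of `g` below `b` have index `≤ 1`: a closed-open part of the straightened `X₂`
missing both faces would carry a maximum of `ψ₂` at an interior point, a critical point of index
`4 = dim`, whereas all interior critical points have index `≤ 1`. [cite: GayKirby2016, §4, Lemma 14] [cite: MilnorHCobordism1965, proof of Thm. 9.1] -/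
theorem connectedSpace_X₂ (hidx : ∀ y, IsMCriticalPt (𝓡 3) B.g y → B.g y < B.b → morseIndex (𝓡 3) B.g y ≤ 1)
    (h₁₂ : IsConnected (T.X₂ ∩ T.X₁)) (h₂₃ : IsConnected (T.X₂ ∩ T.X₃)) : ConnectedSpace T.X₂ := by
  letI := (T.cornerSliceAtlas₂ 𝔔.hc2 𝔉.two_mul_ε_le 𝔉.linkCondition).chartedSpace
  set Φ := T.cornerSliceAtlas₂ 𝔔.hc2 𝔉.two_mul_ε_le 𝔉.linkCondition with hΦ
  haveI := Φ.isManifold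
  haveI : CompactSpace T.X₂ := T.compactSpace_X₂
  -- the adapted Morse function `ψ₂ ∘ val` and its indices
  have hcorner : ∀ (p : T.X₂) (hp : p.1 ∈ B.surface), ∃ G : EuclideanSpace ℝ (Fin 4) → ℝ,
      ContDiffAt ℝ ∞ G (cornerFold ((Φ.cornerDatum p hp).Θ p.1)) ∧
      fderiv ℝ G (cornerFold ((Φ.cornerDatum p hp).Θ p.1)) ≠ 0 ∧
      ∀ q ∈ (Φ.cornerDatum p hp).Θ.source, q ∈ T.X₂ → 𝔔.psiTwo q = G (cornerFold ((Φ.cornerDatum p hp).Θ q)) :=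
    fun p hp => ⟨𝔔.cornerG, 𝔔.contDiff_cornerG.contDiffAt, 𝔔.fderiv_cornerG_ne_zero _, fun q hq _ => 𝔔.psiTwo_eq_cornerG hq⟩
  have hb1 : ∀ p : T.X₂, (𝓡∂ 4).IsBoundaryPoint p → 𝔔.psiTwo p.1 = 1 := fun p hb =>
    𝔔.psiTwo_eq_one_of_boundary 𝔔.hc2 p.2 ((T.isBoundaryPoint_iff₂' 𝔔.hc2 𝔉.two_mul_ε_le 𝔉.linkCondition p).1 hb)
  have hb2 : ∀ p : T.X₂, (𝓡∂ 4).IsBoundaryPoint p → p.1 ∉ B.surface → ¬ IsMCriticalPt (𝓡 4) 𝔔.psiTwo p.1 := by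
    intro p hb hpK
    rcases (T.isBoundaryPoint_iff₂' 𝔔.hc2 𝔉.two_mul_ε_le 𝔉.linkCondition p).1 hb with h | h0 | hM
    · exact absurd h hpK
    · exact 𝔔.not_isMCriticalPt_psiTwo_of_F₁_eq_zero p.2 h0 hpK
    · by_cases h0 : T.D.F₁ p.1 = 0
      · exact 𝔔.not_isMCriticalPt_psiTwo_of_F₁_eq_zero p.2 h0 hpK
      · exact 𝔔.not_isMCriticalPt_psiTwo_of_Mt_eq_zero p.2 h0 hM
  have hi1 : ∀ p : T.X₂, (𝓡∂ 4).IsInteriorPoint p → 𝔔.psiTwo p.1 < 1 := fun p hi => by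
    obtain ⟨-, h0, hM⟩ := (T.isInteriorPoint_iff₂ 𝔔.hc2 𝔉.two_mul_ε_le 𝔉.linkCondition p).1 hi
    exact 𝔔.psiTwo_lt_one_of_interior 𝔔.hc2 p.2 h0 hM
  have hi2 : ∀ p : T.X₂, (𝓡∂ 4).IsInteriorPoint p → IsMCriticalPt (𝓡 4) 𝔔.psiTwo p.1 →
      (mhessian (𝓡 4) 𝔔.psiTwo p.1).Nondegenerate := fun p hi hc => by
    obtain ⟨-, h0, hM⟩ := (T.isInteriorPoint_iff₂ 𝔔.hc2 𝔉.two_mul_ε_le 𝔉.linkCondition p).1 hi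
    rcases 𝔔.mem_FR_or_exists_mem_col p.2 h0 hM hc with hFR | ⟨j, hcol⟩
    · exact (𝔔.morseData_psiTwo_of_mem_FR hgM hFR p.2 hM hc).1
    · have hq : p.1 = 𝔉.boxes.cpt j := 𝔔.eq_cpt_of_isMCriticalPt_psiTwo_of_mem_col hcol hc
      rw [hq]; exact (𝔔.morseData_psiTwo_cpt j).2.1
  have hMA := Φ.isMorseAdapted_comp_val (F := 𝔔.psiTwo) (fun q hq _ => 𝔔.contMDiffAt_psiTwo hq) hcorner hb1 hb2 hi1 hi2
  have hMorse := hMA.1.isMorse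
  -- the two faces, seen in `↥X₂`, form a preconnected set containing the boundary
  set Bd : Set T.X₂ := (Subtype.val : T.X₂ → X) ⁻¹' (T.X₁ ∪ T.X₃) with hBd
  have hBd_conn : IsPreconnected Bd := by
    have hval : Bd = (Subtype.val : T.X₂ → X) ⁻¹' ((T.X₂ ∩ T.X₁) ∪ (T.X₂ ∩ T.X₃)) := by
      ext p; simp only [hBd, mem_preimage, mem_union, mem_inter_iff, p.2, true_and]
    rw [hval]
    have hne : ((T.X₂ ∩ T.X₁) ∩ (T.X₂ ∩ T.X₃)).Nonempty := by
      obtain ⟨z⟩ := B.nonempty_F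
      set x : X := RegularLevel.incl B.hf (RegularLevel.incl B.hg z)
      have hx : x ∈ B.surface := ⟨z, rfl⟩
      exact ⟨x, ⟨T.surface_subset_X₂ hx, show T.D.F₁ x ≤ 0 from (T.D.F₁_eq_zero_of_mem_surface hx).le⟩,
        T.surface_subset_X₂ hx, T.surface_subset_X₃ hx⟩
    have hunion : IsConnected ((T.X₂ ∩ T.X₁) ∪ (T.X₂ ∩ T.X₃)) := by
      obtain ⟨x, hx1, hx3⟩ := hne
      exact IsConnected.union ⟨x, hx1, hx3⟩ h₁₂ h₂₃
    -- pull back along the embedding `val`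
    have himg : (Subtype.val : T.X₂ → X) ⁻¹' ((T.X₂ ∩ T.X₁) ∪ (T.X₂ ∩ T.X₃)) =
        (fun x : ((T.X₂ ∩ T.X₁) ∪ (T.X₂ ∩ T.X₃) : Set X) => (⟨x.1, x.2.elim (fun h => h.1) (fun h => h.1)⟩ : T.X₂)) '' univ := by
      ext p
      simp only [mem_preimage, mem_image, mem_univ, true_and]
      constructor
      · intro hp; exact ⟨⟨p.1, hp⟩, Subtype.ext rfl⟩
      · rintro ⟨x, rfl⟩; exact x.2
    rw [himg]
    haveI : ConnectedSpace ((T.X₂ ∩ T.X₁) ∪ (T.X₂ ∩ T.X₃) : Set X) := isConnected_iff_connectedSpace.1 hunion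
    exact (isPreconnected_univ.image _ ((continuous_subtype_val.subtype_mk _).continuousOn))
  have hBd_of_boundary : ∀ p : T.X₂, (𝓡∂ 4).IsBoundaryPoint p → p ∈ Bd := by
    intro p hb
    rcases (T.isBoundaryPoint_iff₂' 𝔔.hc2 𝔉.two_mul_ε_le 𝔉.linkCondition p).1 hb with h | h0 | hM
    · exact Or.inl (show T.D.F₁ p.1 ≤ 0 from (T.D.F₁_eq_zero_of_mem_surface h).le)
    · exact Or.inl (show T.D.F₁ p.1 ≤ 0 from h0.le)
    · right
      by_cases hh : B.Hit p.1
      · by_cases h1 : p.1 ∈ T.X₁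
        · -- then `F₁ = 0`, still fine via `X₁`? we need `X₃`; use the closure of `S₃`
          have h0 : T.D.F₁ p.1 = 0 := T.F₁_eq_zero_of_mem_X₁_X₂ h1 p.2
          have hM0 : T.M p.1 = 0 := by rwa [T.Mt_of_hit hh] at hM
          -- a band point with `M = 0` has `r = 0`... it lies on the surface, hence in `X₃`
          have hband : |B.sFun p.1| < B.U.δ := (T.D.abs_sFun_lt_rIn_of_F₁_eq_zero h0).trans T.D.rIn₁_lt
          have hxb : p.1 ∈ B.U.band := B.mem_band_U hband
          have hr : B.rFun p.1 = 0 := by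
            rcases T.M_eq_rFun_or_of_mem_band 𝔔.hc2 hxb with h | h
            · rw [← h]; exact hM0
            · exfalso; linarith [h.2, T.ε_pos]
          by_contra h3
          have hps : p.1 ∉ B.surface := fun hs => h3 (T.surface_subset_X₃ hs)
          have hneg := T.rFun_neg_of_mem_X₂ 𝔔.hc2 p.2 h0 hps
          linarith
        · exact Or.inl (T.mem_closure_S₃_of_M_eq_zero h1 hh (by rwa [T.Mt_of_hit hh] at hM))
      · have hfc : B.f p.1 = T.c := by rw [T.Mt_of_not_hit hh] at hM; linarith
        exact T.mem_X₃_of_le hfc.ge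
  have hint_of_not_mem : ∀ p : T.X₂, p ∉ Bd → (𝓡∂ 4).IsInteriorPoint p := fun p hp => by
    by_contra hni
    exact hp (hBd_of_boundary p (((𝓡∂ 4).isBoundaryPoint_iff_not_isInteriorPoint p).2 hni))
  -- the clopen argument
  rw [connectedSpace_iff_clopen]
  obtain ⟨z⟩ := B.nonempty_F
  refine ⟨⟨⟨_, T.surface_subset_X₂ ⟨z, rfl⟩⟩⟩, fun U hU => ?_⟩
  by_contra hne
  push Not at hne
  obtain ⟨V, hV, hVne, hBV⟩ : ∃ V : Set T.X₂, IsClopen V ∧ V.Nonempty ∧ ∀ p ∈ V, p ∉ Bd := by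
    by_cases h : (Bd ∩ U).Nonempty
    · have hBU : Bd ⊆ U := hBd_conn.subset_isClopen hU h
      refine ⟨Uᶜ, hU.compl, ?_, fun p hp hpB => hp (hBU hpB)⟩
      rw [nonempty_compl]; exact hne.2
    · exact ⟨U, hU, hne.1, fun p hp hpB => h ⟨p, hpB, hp⟩⟩
  -- the maximum of `ψ₂ ∘ val` on `V` is an interior critical point of index `4`
  have hcont : Continuous (𝔔.psiTwo ∘ (Subtype.val : T.X₂ → X)) :=
    continuous_iff_continuousAt.2 fun p => ((𝔔.contMDiffAt_psiTwo p.2).continuousAt).comp continuous_subtype_val.continuousAt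
  obtain ⟨x, hxV, hmax⟩ := hV.isClosed.isCompact.exists_isMaxOn hVne hcont.continuousOn
  have hloc : IsLocalMax (𝔔.psiTwo ∘ (Subtype.val : T.X₂ → X)) x := hmax.isLocalMax (hV.isOpen.mem_nhds hxV)
  have hint : (𝓡∂ 4).IsInteriorPoint x := hint_of_not_mem x (hBV x hxV)
  have hcrit : IsMCriticalPt (𝓡∂ 4) (𝔔.psiTwo ∘ (Subtype.val : T.X₂ → X)) x := isMCriticalPt_of_isLocalMax hloc hint
  have hmin : IsLocalMin (fun y => 0 - (𝔔.psiTwo ∘ (Subtype.val : T.X₂ → X)) y) x := by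
    have h' := hloc.neg
    simp only [zero_sub]
    exact h'
  have hsmooth : ContMDiffAt (𝓡∂ 4) 𝓘(ℝ, ℝ) ∞ (𝔔.psiTwo ∘ (Subtype.val : T.X₂ → X)) x := hMorse.contMDiff x
  have h0 : morseIndex (𝓡∂ 4) (fun y => 0 - (𝔔.psiTwo ∘ (Subtype.val : T.X₂ → X)) y) x = 0 :=
    morseIndex_eq_zero_of_isLocalMin_of_isInteriorPoint ((contMDiffAt_const.sub hsmooth).of_le (by norm_cast)) hmin hint
  have hadd := hMorse.morseIndex_const_sub_add 0 hcrit
  rw [h0, finrank_euclideanSpace_fin] at hadd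
  -- read the index on the ambient function: `x.1 ∈ frCrit 4 = ∅`
  have hidx4 : morseIndex (𝓡∂ 4) (𝔔.psiTwo ∘ (Subtype.val : T.X₂ → X)) x = 4 := by omega
  have hmem : x.1 ∈ (Subtype.val : T.X₂ → X) '' criticalSetOfIndex (𝓡∂ 4) (𝔔.psiTwo ∘ (Subtype.val : T.X₂ → X)) 4 :=
    ⟨x, mem_criticalSetOfIndex.2 ⟨hcrit, hidx4⟩, rfl⟩
  rw [Φ.image_criticalSetOfIndex_comp_val (fun q hq _ => 𝔔.contMDiffAt_psiTwo hq) hcorner hb1 hb2 hi1 hi2 4,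
    𝔔.image_interior_inter_criticalSetOfIndex 4, if_neg (by norm_num), union_empty, 𝔔.frCrit_eq_empty hgM hεT hidx (by norm_num)] at hmem
  exact hmem

include hgM hεT in
/-- **The straightened middle sector has a handle decomposition with one `0`-handle and `k₂`
`1`-handles** for the `k₂` with `k₂ + (#critY₀ + m) = #critY₁ + 1` (Milnor 1965, Thm. 8.1: the
surplus `0`-handles of `hasHandleDecomposition_X₂` cancel; `X₂` is connected by
`connectedSpace_X₂`) — the shape of the hypothesis `h₂` of `isGKTrisection_of_handles`. [cite: GayKirby2016, §4, Lemma 14] [cite: MilnorHCobordism1965, Thm. 8.1] -/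
theorem exists_hasHandleDecomposition_X₂_handleCount [SecondCountableTopology X]
    (hidx : ∀ y, IsMCriticalPt (𝓡 3) B.g y → B.g y < B.b → morseIndex (𝓡 3) B.g y ≤ 1)
    (h₁₂ : IsConnected (T.X₂ ∩ T.X₁)) (h₂₃ : IsConnected (T.X₂ ∩ T.X₃)) :
    letI := (T.cornerSliceAtlas₂ 𝔔.hc2 𝔉.two_mul_ε_le 𝔉.linkCondition).chartedSpace
    ∃ k₂ : ℕ, k₂ + 𝔉.countMid 0 = 𝔉.countMid 1 + 1 ∧ HasHandleDecomposition 3 T.X₂ (handleCount 1 k₂) := by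
  letI := (T.cornerSliceAtlas₂ 𝔔.hc2 𝔉.two_mul_ε_le 𝔉.linkCondition).chartedSpace
  haveI := (T.cornerSliceAtlas₂ 𝔔.hc2 𝔉.two_mul_ε_le 𝔉.linkCondition).isManifold
  haveI : CompactSpace T.X₂ := T.compactSpace_X₂
  haveI : ConnectedSpace T.X₂ := 𝔔.connectedSpace_X₂ hgM hεT hidx h₁₂ h₂₃
  obtain ⟨z⟩ := B.nonempty_F
  haveI : Nonempty T.X₂ := ⟨⟨_, T.surface_subset_X₂ ⟨z, rfl⟩⟩⟩
  exact (𝔔.hasHandleDecomposition_X₂ hgM hεT).exists_handleCount_one fun k hk => 𝔔.countMid_eq_zero hgM hεT hidx hk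

end Handles

end MidParams

end TubeFrame

end TriData

end BiCollar

end Literature.Topology.FourManifolds

end
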